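import Mathlib
import Literature.NumberTheory.Sieve.Maynard2016LamSupport
import HarnessLib

/-!
# Maynard 2016: `|λ_{d,e}| ≪_k 1`

Topic `Literature/NumberTheory/Sieve`. J. Maynard, *Large gaps between primes*, Ann. of Math. (2)
183 (2016), 915–933 = arXiv:1408.5110, §5 display (5.3) and §6, proof of Lemma 7, after (6.29):
"(here we used `|λ_{d,e}| ≪_k 1` for all `d, e`)". Since the `F_{ℓ,j}` and `G` are smooth, the
`F_{ℓ,j}` vanish (jointly) off `Σ u_ℓ ≤ 1/10` on `[0,∞)^k` and `G` vanishes off `[0,1]`, and the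
arguments `log d_ℓ/log x`, `log e_ℓ/log y` are `≥ 0` when `log x, log y > 0`, the weights
`λ_{d,e} = (∏ μ(d_ℓ)μ(e_ℓ)) Σ_j c_j ∏_ℓ F_{ℓ,j}(log d_ℓ/log x) G(log e_ℓ/log y)` are bounded by a
constant depending only on the sieve data.

PROVED here (no named facts): `exists_abs_lam_le`.

## References

* J. Maynard, *Large gaps between primes*, Ann. of Math. (2) 183 (2016), 915–933; arXiv:1408.5110,
  §5 (5.3)–(5.4) and Lemma 7 (proof). [Maynard2016LargeGaps]
-/

open Filter Finset
open scoped Topology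

namespace Literature.NumberTheory.Sieve

namespace Maynard2016

/-- A continuous real function is bounded on `[a, b]` by some `M ≥ 0`. [folklore] -/
private theorem exists_abs_le_on_Icc (f : ℝ → ℝ) (hf : Continuous f) (a b : ℝ) :
    ∃ M : ℝ, 0 ≤ M ∧ ∀ u ∈ Set.Icc a b, |f u| ≤ M := by
  obtain ⟨C, hC⟩ :=
    (isCompact_Icc : IsCompact (Set.Icc a b)).exists_bound_of_continuousOn hf.continuousOn
  refine ⟨max C 0, le_max_right _ _, fun u hu => le_trans ?_ (le_max_left _ _)⟩
  simpa [Real.norm_eq_abs] using hC u hu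

/-- `|μ(n)| ≤ 1` in `ℝ`. [folklore] -/
private theorem abs_moebius_cast_le_one (n : ℕ) :
    |((ArithmeticFunction.moebius n : ℤ) : ℝ)| ≤ 1 := by
  rw [← Int.cast_abs]
  exact_mod_cast ArithmeticFunction.abs_moebius_le_one

/-- **`|λ_{d,e}| ≪_k 1`:** there is `Λ ≥ 0`, depending only on the sieve data, with
`|λ_{d_1,…,d_k,e_1,…,e_k}| ≤ Λ` for all `d, e`, all `ε` and all `x` with `log x > 0` and
`log y > 0`. [cite: Maynard2016LargeGaps, Lemma 7 (proof, «|λ_{d,e}| ≪_k 1 for all d, e»)] -/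
theorem exists_abs_lam_le {k J : ℕ} {c : Fin J → ℝ} {Fd : Fin k → Fin J → ℝ → ℝ} {G : ℝ → ℝ}
    (hD : IsSieveData k J c Fd G) :
    ∃ Λ : ℝ, 0 ≤ Λ ∧ ∀ (ε : ℝ) (x : ℕ) (d e : Fin k → ℕ), 0 < Real.log x →
      0 < Real.log (y ε x) → |lam c Fd G ε x d e| ≤ Λ := by
  choose M hM0 hM using
    fun ℓ j => exists_abs_le_on_Icc (Fd ℓ j) (hD.Fd_smooth ℓ j).continuous 0 (1 / 10)
  obtain ⟨MG, hMG0, hMG⟩ := exists_abs_le_on_Icc G hD.G_smooth.continuous 0 1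
  have hΛ0 : 0 ≤ ∑ j, c j * ∏ ℓ, (M ℓ j * MG) :=
    Finset.sum_nonneg fun j _ => mul_nonneg (hD.c_pos j).le
      (Finset.prod_nonneg fun ℓ _ => mul_nonneg (hM0 ℓ j) hMG0)
  refine ⟨∑ j, c j * ∏ ℓ, (M ℓ j * MG), hΛ0, ?_⟩
  intro ε x d e hlogx hlogy
  have hu0 : ∀ ℓ, 0 ≤ Real.log (d ℓ) / Real.log x := fun ℓ =>
    div_nonneg (Real.log_natCast_nonneg _) hlogx.le
  have hv0 : ∀ ℓ, 0 ≤ Real.log (e ℓ) / Real.log (y ε x) := fun ℓ =>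
    div_nonneg (Real.log_natCast_nonneg _) hlogy.le
  -- `|G(v)| ≤ MG` for `v ≥ 0`
  have hGb : ∀ ℓ, |G (Real.log (e ℓ) / Real.log (y ε x))| ≤ MG := by
    intro ℓ
    rcases le_or_gt (Real.log (e ℓ) / Real.log (y ε x)) 1 with h | h
    · exact hMG _ ⟨hv0 ℓ, h⟩
    · rw [hD.G_support _ h, abs_zero]; exact hMG0
  unfold lam
  rw [abs_mul]
  have hμ : |∏ i, ((ArithmeticFunction.moebius (d i) : ℤ) : ℝ) *
      ((ArithmeticFunction.moebius (e i) : ℤ) : ℝ)| ≤ 1 := by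
    rw [Finset.abs_prod]
    refine Finset.prod_le_one (fun i _ => abs_nonneg _) fun i _ => ?_
    rw [abs_mul]
    exact mul_le_one₀ (abs_moebius_cast_le_one _) (abs_nonneg _) (abs_moebius_cast_le_one _)
  have hS : |∑ j, c j * ∏ ℓ, Fd ℓ j (Real.log (d ℓ) / Real.log x) *
      G (Real.log (e ℓ) / Real.log (y ε x))| ≤ ∑ j, c j * ∏ ℓ, (M ℓ j * MG) := by
    refine (Finset.abs_sum_le_sum_abs _ _).trans (Finset.sum_le_sum fun j _ => ?_)
    rw [abs_mul, abs_of_pos (hD.c_pos j)]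
    refine mul_le_mul_of_nonneg_left ?_ (hD.c_pos j).le
    rw [Finset.abs_prod]
    by_cases hall : ∀ ℓ, Fd ℓ j (Real.log (d ℓ) / Real.log x) ≠ 0
    · have hsum := hD.Fd_support j (fun ℓ => Real.log (d ℓ) / Real.log x) hu0 hall
      refine Finset.prod_le_prod (fun ℓ _ => abs_nonneg _) fun ℓ _ => ?_
      rw [abs_mul]
      have hle : Real.log (d ℓ) / Real.log x ≤ 1 / 10 :=
        le_trans (Finset.single_le_sum (fun i _ => hu0 i) (Finset.mem_univ ℓ)) hsum
      exact mul_le_mul (hM ℓ j _ ⟨hu0 ℓ, hle⟩) (hGb ℓ) (abs_nonneg _) (hM0 ℓ j)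
    · obtain ⟨ℓ₀, hℓ₀⟩ := not_forall.1 hall
      have h0 : Fd ℓ₀ j (Real.log (d ℓ₀) / Real.log x) = 0 := not_not.1 hℓ₀
      rw [Finset.prod_eq_zero (Finset.mem_univ ℓ₀) (by rw [abs_mul, h0, abs_zero, zero_mul])]
      exact Finset.prod_nonneg fun ℓ _ => mul_nonneg (hM0 ℓ j) hMG0
  calc _ ≤ 1 * ∑ j, c j * ∏ ℓ, (M ℓ j * MG) := mul_le_mul hμ hS (abs_nonneg _) zero_le_one
    _ = _ := one_mul _

end Maynard2016

end Literature.NumberTheory.Sieve
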